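import Summits.AtomisticToContinuum.BoseEinsteinCondensation.Theses.BECHeatBathGap
import Summits.AtomisticToContinuum.BoseEinsteinCondensation.Theorems.BECHeatBathGapIdealGasTensorisationEfronStein
import Literature.MathematicalPhysics.QuantumManyBody.BoseGasCatStates
import HarnessLib

/-!
# Route `BECHeatBathGap`, support item `IdealGasTensorisation` (stmt-AtomisticToContinuum-14374)

**The ideal-gas rung of the heat-bath-gap route**: the approximate-tensorisation (AT) clause of
the crux `ParticleTensorisation` (A1) holds at `v = 0`, at every density, with the Θ-independent
constant `C = 2`: for every `ρ > 0`, all `N ≥ 1` and every slack `δ > 0` some `δ`-near-minimiser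
`Θ` of the FREE `N`-body Dirichlet energy in the box of side `((N+1)/ρ)^{1/3}` satisfies
`min_c ∫_{Λ^N} |F − cΘ|² ≤ 2 Σᵢ ∫_{Λ^N} |F − gᵢ Θ|²` for all bounded measurable `F` and bounded
measurable predictors `gᵢ` not depending on `xᵢ`.

Proof (the item's sketch, [EfronStein1981] / BBL04 §2 Thms 5–6 and [LSSY2005] definitions):

* `exists_powFun_nearMinimiser` — the witness is the tensor power `Θ = φ^{⊗N}` of a one-body
  Dirichlet state `φ` of `Λ_L` with `𝓔[φ] ≤ e₁ + δ/N`, `e₁ = E₀(1, L)` the one-body infimum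
  (finite: `groundStateEnergy_one_lt_top`); `𝓔[φ^{⊗N}] = N 𝓔[φ]` (`rawEnergy_zero_powFun`) and
  `E₀(N, L) ≥ N e₁` (slice-wise one-body bound = `mul_groundStateEnergy_le` at `v = 0`), so
  `Θ` is a `δ`-near-minimiser.
* `exists_setLIntegral_sub_mul_powFun_sq_le` — the AT clause for `Θ = φ^{⊗N}`: the Born law
  `|Θ|² dX` is the product `⨂ᵢ |φ|²dx` (`pi_withDensity_eq`), so for `f = F/Θ` the complex
  Efron–Stein inequality in Steele's form (`exists_lintegral_nnnorm_sub_sq_le`, constant `2`)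
  gives `∫ |f − c|² |Θ|² ≤ 2 Σᵢ ∫ |f − gᵢ|² |Θ|²`, i.e. `∫_{Θ≠0} |F − cΘ|² ≤ 2 Σᵢ ∫_{Θ≠0} |F − gᵢΘ|²`
  (division-free: `fΘ = F·1_{Θ≠0}`); on `Λ^N ∩ {Θ = 0}` both sides carry `∫ |F|²`, once on the
  left and `2N ≥ 1` times on the right.
* `idealGasTensorisation_proof` — the route decl, closing stmt-AtomisticToContinuum-14374.

No new definitions (the product trial state is built inline from `BoseGas.powFun`).
-/

noncomputable section

open MeasureTheory Function
open scoped ENNReal NNReal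

namespace Summit.AtomisticToContinuum.BoseEinsteinCondensation.Theorems

open Literature.MathematicalPhysics.QuantumManyBody.BoseGas

namespace IdealGasTensorisation

variable {N : ℕ} {L : ℝ}

/-! ### The one-body mode of a one-particle Dirichlet state and its tensor power -/

/-- The mode `x ↦ φ(x)` of a one-particle state, read on one-particle configurations, is `φ`.
[folklore] -/
theorem oneFun_mode (φ : TrialState 1 L) : oneFun (fun x => φ.ψ fun _ => x) = φ.ψ :=
  funext fun Y => congrArg φ.ψ (const_apply_zero_eq Y)

/-- The mode of a one-particle Dirichlet state is `C¹`. [folklore] -/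
theorem contDiff_oneFun_mode (φ : TrialState 1 L) :
    ContDiff ℝ 1 (oneFun fun x => φ.ψ fun _ => x) := by
  rw [oneFun_mode]
  exact φ.contDiff

/-- The mode of a one-particle Dirichlet state is normalised (one-particle configurations).
[folklore] -/
theorem lintegral_oneFun_mode_sq (φ : TrialState 1 L) :
    ∫⁻ Y, (‖oneFun (fun x => φ.ψ fun _ => x) Y‖₊ : ℝ≥0∞) ^ 2 = 1 := by
  rw [oneFun_mode]
  exact φ.norm_eq

/-- The mode of a one-particle Dirichlet state is normalised: `∫ |φ(x)|² dx = 1`. [folklore] -/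
theorem lintegral_mode_sq (φ : TrialState 1 L) :
    ∫⁻ x, (‖φ.ψ fun _ => x‖₊ : ℝ≥0∞) ^ 2 = 1 := by
  rw [← lintegral_funUnique_comp (fun x => (‖φ.ψ fun _ => x‖₊ : ℝ≥0∞) ^ 2)]
  exact lintegral_oneFun_mode_sq φ

/-- The mode of a one-particle Dirichlet state of `Λ_L` vanishes off the open box. [folklore] -/
theorem mode_eq_zero (φ : TrialState 1 L) {x : Space} (hx : x ∉ box L) :
    φ.ψ (fun _ => x) = 0 :=
  φ.eq_zero _ (by simpa [boxN] using hx)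

/-- The mode of a one-particle Dirichlet state is continuous. [folklore] -/
theorem continuous_mode (φ : TrialState 1 L) : Continuous fun x : Space => φ.ψ fun _ => x :=
  φ.contDiff.continuous.comp (continuous_pi fun _ => continuous_id)

/-- The tensor power `φ^{⊗N}` vanishes off the box `Λ_L^N`. [folklore] -/
theorem powFun_mode_eq_zero (φ : TrialState 1 L) {X : Config N} (hX : X ∉ boxN N L) :
    powFun (fun x => φ.ψ fun _ => x) N X = 0 := by
  have : ∃ i, X i ∉ box L := by simpa [boxN] using hX
  obtain ⟨i, hi⟩ := this
  exact powFun_eq_zero_of_exists _ ⟨i, mode_eq_zero φ hi⟩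

/-- Where the tensor power does not vanish, the configuration is in the box. [folklore] -/
theorem mem_boxN_of_powFun_ne_zero (φ : TrialState 1 L) {X : Config N}
    (hX : powFun (fun x => φ.ψ fun _ => x) N X ≠ 0) : X ∈ boxN N L := by
  by_contra h
  exact hX (powFun_mode_eq_zero φ h)

/-- The Born density of the tensor power is the product of the one-body Born densities:
`∏ᵢ |φ(xᵢ)|² = |φ^{⊗N}(X)|²`. [folklore] -/
theorem prod_nnnorm_mode_sq (φ : TrialState 1 L) (X : Config N) :
    ∏ i, (‖φ.ψ fun _ => X i‖₊ : ℝ≥0∞) ^ 2 =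
      (‖powFun (fun x => φ.ψ fun _ => x) N X‖₊ : ℝ≥0∞) ^ 2 := by
  rw [powFun, nnnorm_prod, ENNReal.ofNNReal_finsetProd, Finset.prod_pow]

/-! ### The witness: a tensor power near-minimises the free Dirichlet energy -/

/-- **The free product witness.** For `L > 0`, `N ≥ 1` and every slack `δ > 0` there is a
one-particle Dirichlet state `φ` of `Λ_L` whose tensor power `Θ = φ^{⊗N}` — a Bose-symmetric
Dirichlet trial state — is a `δ`-near-minimiser of the FREE `N`-body Dirichlet energy:
choose `𝓔[φ] < e₁ + δ/N` (`e₁ = E₀(1, L) < ∞`); then `𝓔[φ^{⊗N}] = N 𝓔[φ] ≤ N e₁ + δ ≤ E₀(N, L) + δ`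
by `N e₁ ≤ E₀(N, L)` (superadditivity of the Dirichlet energy in the particle number at `v = 0`,
i.e. the one-body bound applied slice-wise). [folklore] -/
theorem exists_powFun_nearMinimiser (hL : 0 < L) (hN : 0 < N) {δ : ℝ≥0∞} (hδ : 0 < δ) :
    ∃ (φ : TrialState 1 L) (Θ : TrialState N L), Θ.ψ = powFun (fun x => φ.ψ fun _ => x) N ∧
      energy 0 Θ ≤ groundStateEnergy 0 N L + δ := by
  have hNtop : (N : ℝ≥0∞) ≠ ⊤ := ENNReal.natCast_ne_top N
  have hN0 : (N : ℝ≥0∞) ≠ 0 := Nat.cast_ne_zero.2 hN.ne'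
  have hδN : 0 < δ / N := ENNReal.div_pos hδ.ne' hNtop
  have he₁ : groundStateEnergy 0 1 L < ⊤ := groundStateEnergy_one_lt_top 0 hL
  have hlt : groundStateEnergy 0 1 L < groundStateEnergy 0 1 L + δ / N :=
    ENNReal.lt_add_right he₁.ne hδN.ne'
  obtain ⟨φ, hφ⟩ := iInf_lt_iff.1 hlt
  have hu : ContDiff ℝ 1 (oneFun fun x => φ.ψ fun _ => x) := contDiff_oneFun_mode φ
  have h1 := lintegral_oneFun_mode_sq φ
  let Θ : TrialState N L :=
    { ψ := powFun (fun x => φ.ψ fun _ => x) N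
      contDiff := contDiff_powFun hu N
      eq_zero := fun X hX => powFun_mode_eq_zero φ hX
      symm := fun σ X => powFun_comp_perm _ σ X
      norm_eq := lintegral_powFun_sq hu h1 N }
  refine ⟨φ, Θ, rfl, ?_⟩
  have hE : energy 0 Θ = N * energy 0 φ := by
    rw [energy_eq_rawEnergy, energy_eq_rawEnergy, show Θ.ψ = powFun (fun x => φ.ψ fun _ => x) N
      from rfl, rawEnergy_zero_powFun hu h1 N, oneFun_mode]
  have hlow : (N : ℝ≥0∞) * groundStateEnergy 0 1 L ≤ groundStateEnergy 0 N L := by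
    have h := mul_groundStateEnergy_le (v := 0) measurable_const L 1 N 0
    simpa using h
  calc energy 0 Θ = N * energy 0 φ := hE
    _ ≤ N * (groundStateEnergy 0 1 L + δ / N) := by gcongr
    _ = N * groundStateEnergy 0 1 L + δ := by rw [mul_add, ENNReal.mul_div_cancel hN0 hNtop]
    _ ≤ groundStateEnergy 0 N L + δ := add_le_add hlow le_rfl

/-! ### Approximate tensorisation over particle labels for a tensor power -/

/-- **The AT clause for a tensor power (Efron–Stein, division-free form).** Let `Θ = φ^{⊗N}`
for a one-particle Dirichlet state `φ` of `Λ_L`, `N ≥ 1`. For every bounded measurable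
`F : Λ^N → ℂ` and bounded measurable predictors `gᵢ` with `gᵢ(X with xᵢ := x) = gᵢ(X)` there is
`c ∈ ℂ` with `∫_{Λ^N} |F − cΘ|² ≤ 2 Σᵢ ∫_{Λ^N} |F − gᵢΘ|²`. Proof: the Born law `|Θ|² dX` is the
product probability law `⨂ᵢ |φ|² dx` (`pi_withDensity_eq`); the complex Efron–Stein inequality
in Steele's form (`exists_lintegral_nnnorm_sub_sq_le`) for `f = F/Θ ∈ L²(|Θ|² dX)` reads, after
multiplying the integrands by `|Θ|²`, `∫_{Θ≠0} |F − cΘ|² ≤ 2 Σᵢ ∫_{Θ≠0} |F − gᵢΘ|²`; on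
`Λ^N ∩ {Θ = 0}` the two sides carry `∫ |F|²` resp. `2N ∫ |F|²`.
[cite: BoucheronBousquetLugosi2004, §2 Thms 5–6] -/
theorem exists_setLIntegral_sub_mul_powFun_sq_le (hN : 0 < N) (φ : TrialState 1 L)
    (F : Config N → ℂ) (g : Fin N → Config N → ℂ) (hF : Measurable F)
    (hg : ∀ i, Measurable (g i)) (hbd : ∃ M : ℝ, ∀ X, ‖F X‖ ≤ M ∧ ∀ i, ‖g i X‖ ≤ M)
    (hupd : ∀ i X x, g i (Function.update X i x) = g i X) :
    ∃ c : ℂ, (∫⁻ X in boxN N L,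
        (‖F X - c * powFun (fun x => φ.ψ fun _ => x) N X‖₊ : ℝ≥0∞) ^ 2) ≤
      ENNReal.ofReal 2 * ∑ i : Fin N, ∫⁻ X in boxN N L,
        (‖F X - g i X * powFun (fun x => φ.ψ fun _ => x) N X‖₊ : ℝ≥0∞) ^ 2 := by
  classical
  obtain ⟨M, hM⟩ := hbd
  set u : Space → ℂ := fun x => φ.ψ fun _ => x with hu
  set Θ : Config N → ℂ := powFun u N with hΘ
  have hu_cont : Continuous u := continuous_mode φ
  have hΘ_cont : Continuous Θ := (contDiff_powFun (contDiff_oneFun_mode φ) N).continuous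
  have hΘm : Measurable Θ := hΘ_cont.measurable
  have hΘbox : ∀ {X}, Θ X ≠ 0 → X ∈ boxN N L := fun h => mem_boxN_of_powFun_ne_zero φ h
  -- the one-body Born law `|φ|² dx`, a probability measure, and its `N`-th power
  set ρ : Space → ℝ≥0∞ := fun x => (‖u x‖₊ : ℝ≥0∞) ^ 2 with hρ
  have hρm : Measurable ρ := hu_cont.measurable.nnnorm.coe_nnreal_ennreal.pow_const 2
  haveI hprob : IsProbabilityMeasure ((volume : Measure Space).withDensity ρ) :=
    ⟨by rw [withDensity_apply _ MeasurableSet.univ, Measure.restrict_univ]; exact lintegral_mode_sq φ⟩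
  -- the Born law of `Θ` is the product law
  have hπ : Measure.pi (fun _ : Fin N => (volume : Measure Space).withDensity ρ) =
      (volume : Measure (Config N)).withDensity fun X => (‖Θ X‖₊ : ℝ≥0∞) ^ 2 := by
    rw [pi_withDensity_eq volume hρm, ← volume_pi]
    congr 1
    funext X
    exact prod_nnnorm_mode_sq φ X
  have htransfer : ∀ G : Config N → ℝ≥0∞, Measurable G →
      ∫⁻ X, G X ∂Measure.pi (fun _ : Fin N => (volume : Measure Space).withDensity ρ) =
        ∫⁻ X, G X * (‖Θ X‖₊ : ℝ≥0∞) ^ 2 := by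
    intro G hG
    rw [hπ, lintegral_withDensity_eq_lintegral_mul _ (measurable_normSq hΘ_cont) hG]
    exact lintegral_congr fun X => mul_comm _ _
  -- the observable `f = F / Θ` of the product law and its division-free product `F₁ = f Θ`
  set f : Config N → ℂ := fun X => F X / Θ X with hf
  have hfm : Measurable f := (hF.stronglyMeasurable.div hΘ_cont.stronglyMeasurable).measurable
  set F₁ : Config N → ℂ := fun X => f X * Θ X with hF₁
  have hF₁m : Measurable F₁ := hfm.mul hΘm
  have hF₁_eq : ∀ X, F₁ X = if Θ X = 0 then 0 else F X := by
    intro X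
    simp only [hF₁, hf]
    split_ifs with h
    · rw [h, mul_zero]
    · exact div_mul_cancel₀ (F X) h
  -- `f ∈ L²(|Θ|² dX)` because `F` is bounded and the box has finite volume
  have hf2 : MemLp f 2 (Measure.pi fun _ : Fin N => (volume : Measure Space).withDensity ρ) := by
    refine (memLp_two_iff_integrable_sq_norm hfm.aestronglyMeasurable).2
      ⟨(hfm.norm.pow_const 2).aestronglyMeasurable, ?_⟩
    rw [hasFiniteIntegral_iff_ofReal (ae_of_all _ fun X => sq_nonneg _)]
    calc ∫⁻ X, ENNReal.ofReal (‖f X‖ ^ 2)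
          ∂Measure.pi (fun _ : Fin N => (volume : Measure Space).withDensity ρ)
        = ∫⁻ X, (‖f X‖₊ : ℝ≥0∞) ^ 2
            ∂Measure.pi (fun _ : Fin N => (volume : Measure Space).withDensity ρ) := by
          refine lintegral_congr fun X => ?_
          rw [ENNReal.ofReal_pow (norm_nonneg _), ofReal_norm, enorm_eq_nnnorm]
      _ = ∫⁻ X, (‖F₁ X‖₊ : ℝ≥0∞) ^ 2 := by
          rw [htransfer _ (hfm.nnnorm.coe_nnreal_ennreal.pow_const 2)]
          refine lintegral_congr fun X => ?_
          rw [← mul_pow, ← ENNReal.coe_mul, ← nnnorm_mul]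
      _ ≤ ∫⁻ X, (boxN N L).indicator (fun _ => (‖(M : ℂ)‖₊ : ℝ≥0∞) ^ 2) X := by
          refine lintegral_mono fun X => ?_
          by_cases hΘX : Θ X = 0
          · rw [hF₁_eq, if_pos hΘX]
            simp
          · rw [hF₁_eq, if_neg hΘX, Set.indicator_of_mem (hΘbox hΘX)]
            gcongr
            rw [← NNReal.coe_le_coe, coe_nnnorm, coe_nnnorm, Complex.norm_real, Real.norm_eq_abs]
            exact (hM X).1.trans (le_abs_self M)
      _ = ∫⁻ X in boxN N L, (‖(M : ℂ)‖₊ : ℝ≥0∞) ^ 2 := lintegral_indicator (measurableSet_boxN N L) _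
      _ < ⊤ := lintegral_boxN_normSq_lt_top (φ := fun _ => (M : ℂ)) continuous_const L
  -- Efron–Stein (complex, Steele form) for the product law
  obtain ⟨c, hc⟩ := exists_lintegral_nnnorm_sub_sq_le
    (fun _ : Fin N => (volume : Measure Space).withDensity ρ) hfm hf2 hg hupd
  refine ⟨c, ?_⟩
  -- back to Lebesgue measure: multiply the integrands by `|Θ|²`
  have hA0 : ∫⁻ X, (‖f X - c‖₊ : ℝ≥0∞) ^ 2
        ∂Measure.pi (fun _ : Fin N => (volume : Measure Space).withDensity ρ) =
      ∫⁻ X, (‖F₁ X - c * Θ X‖₊ : ℝ≥0∞) ^ 2 := by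
    have hmeas : Measurable fun X => (‖f X - c‖₊ : ℝ≥0∞) ^ 2 :=
      (hfm.sub measurable_const).nnnorm.coe_nnreal_ennreal.pow_const 2
    rw [htransfer _ hmeas]
    refine lintegral_congr fun X => ?_
    rw [← mul_pow, ← ENNReal.coe_mul, ← nnnorm_mul, sub_mul]
  have hAi : ∀ i, ∫⁻ X, (‖f X - g i X‖₊ : ℝ≥0∞) ^ 2
        ∂Measure.pi (fun _ : Fin N => (volume : Measure Space).withDensity ρ) =
      ∫⁻ X, (‖F₁ X - g i X * Θ X‖₊ : ℝ≥0∞) ^ 2 := by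
    intro i
    have hmeas : Measurable fun X => (‖f X - g i X‖₊ : ℝ≥0∞) ^ 2 :=
      (hfm.sub (hg i)).nnnorm.coe_nnreal_ennreal.pow_const 2
    rw [htransfer _ hmeas]
    refine lintegral_congr fun X => ?_
    rw [← mul_pow, ← ENNReal.coe_mul, ← nnnorm_mul, sub_mul]
  -- the pointwise bookkeeping on `{Θ = 0}`
  set R : ℝ≥0∞ := ∫⁻ X, (boxN N L ∩ {X | Θ X = 0}).indicator
    (fun X => (‖F X‖₊ : ℝ≥0∞) ^ 2) X with hR
  have hpt : ∀ (m : Config N → ℂ) (X : Config N),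
      (boxN N L).indicator (fun X => (‖F X - m X * Θ X‖₊ : ℝ≥0∞) ^ 2) X =
        (‖F₁ X - m X * Θ X‖₊ : ℝ≥0∞) ^ 2 +
          (boxN N L ∩ {X | Θ X = 0}).indicator (fun X => (‖F X‖₊ : ℝ≥0∞) ^ 2) X := by
    intro m X
    by_cases hΘX : Θ X = 0
    · have h1 : F₁ X = 0 := by rw [hF₁_eq, if_pos hΘX]
      by_cases hX : X ∈ boxN N L
      · rw [Set.indicator_of_mem hX, Set.indicator_of_mem (show X ∈ boxN N L ∩ {X | Θ X = 0}
          from ⟨hX, hΘX⟩), h1, hΘX]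
        simp
      · rw [Set.indicator_of_notMem hX, Set.indicator_of_notMem
          (show X ∉ boxN N L ∩ {X | Θ X = 0} from fun h => hX h.1), h1, hΘX]
        simp
    · have h1 : F₁ X = F X := by rw [hF₁_eq, if_neg hΘX]
      rw [Set.indicator_of_mem (hΘbox hΘX), Set.indicator_of_notMem
        (show X ∉ boxN N L ∩ {X | Θ X = 0} from fun h => hΘX h.2), h1, add_zero]
  have hint : ∀ m : Config N → ℂ, Measurable m →
      ∫⁻ X in boxN N L, (‖F X - m X * Θ X‖₊ : ℝ≥0∞) ^ 2 =
        (∫⁻ X, (‖F₁ X - m X * Θ X‖₊ : ℝ≥0∞) ^ 2) + R := by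
    intro m hm
    have hmeas : Measurable fun X => (‖F₁ X - m X * Θ X‖₊ : ℝ≥0∞) ^ 2 :=
      ((hF₁m.sub (hm.mul hΘm)).nnnorm.coe_nnreal_ennreal).pow_const 2
    rw [hR, ← lintegral_indicator (measurableSet_boxN N L), ← lintegral_add_left hmeas]
    exact lintegral_congr fun X => hpt m X
  -- assemble
  calc ∫⁻ X in boxN N L, (‖F X - c * Θ X‖₊ : ℝ≥0∞) ^ 2
      = (∫⁻ X, (‖F₁ X - c * Θ X‖₊ : ℝ≥0∞) ^ 2) + R := hint (fun _ => c) measurable_const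
    _ ≤ 2 * (∑ i, ∫⁻ X, (‖f X - g i X‖₊ : ℝ≥0∞) ^ 2
          ∂Measure.pi (fun _ : Fin N => (volume : Measure Space).withDensity ρ)) + N * R := by
        rw [← hA0]
        exact add_le_add hc (le_mul_of_one_le_left (zero_le) (by exact_mod_cast hN))
    _ = ∑ i, ((2 * ∫⁻ X, (‖F₁ X - g i X * Θ X‖₊ : ℝ≥0∞) ^ 2) + R) := by
        rw [Finset.sum_add_distrib, Finset.mul_sum, Finset.sum_const, Finset.card_univ,
          Fintype.card_fin, nsmul_eq_mul]
        congr 1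
        exact Finset.sum_congr rfl fun i _ => by rw [hAi i]
    _ ≤ ∑ i, ENNReal.ofReal 2 * ∫⁻ X in boxN N L, (‖F X - g i X * Θ X‖₊ : ℝ≥0∞) ^ 2 := by
        refine Finset.sum_le_sum fun i _ => ?_
        rw [hint (g i) (hg i), ENNReal.ofReal_ofNat, mul_add]
        exact add_le_add le_rfl (le_mul_of_one_le_left (zero_le) one_le_two)
    _ = ENNReal.ofReal 2 * ∑ i, ∫⁻ X in boxN N L, (‖F X - g i X * Θ X‖₊ : ℝ≥0∞) ^ 2 :=
        (Finset.mul_sum _ _ _).symm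

end IdealGasTensorisation

open IdealGasTensorisation in
/-- **`IdealGasTensorisation` holds** (route `BECHeatBathGap`, closes item
stmt-AtomisticToContinuum-14374): with `C = 2`, for every `ρ > 0`, all `N ≥ 1` and every slack
`δ > 0` the tensor power `Θ = φ^{⊗N}` of a one-body near-minimiser of the free Dirichlet energy
of `Λ_L`, `L = ((N+1)/ρ)^{1/3}`, is a `δ`-near-minimiser of the free `N`-body Dirichlet energy
(`exists_powFun_nearMinimiser`) and satisfies the AT clause of A1 with constant `2`
(`exists_setLIntegral_sub_mul_powFun_sq_le`: Efron–Stein for the product law `|φ|^{2⊗N}` in the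
division-free form). [cite: BoucheronBousquetLugosi2004, §2 Thms 5–6] -/
theorem idealGasTensorisation_proof :
    Summit.AtomisticToContinuum.BoseEinsteinCondensation.Theses.BECHeatBathGap.IdealGasTensorisation := by
  refine ⟨2, two_pos, fun ρ hρ => ?_⟩
  filter_upwards [Filter.eventually_gt_atTop 0] with N hN
  intro δ hδ
  have hL : 0 < sideLength ρ (N + 1) := sideLength_pos_of_pos hρ (Nat.succ_pos N)
  obtain ⟨φ, Θ, hΘ, hE⟩ := exists_powFun_nearMinimiser hL hN hδ
  refine ⟨Θ, hE, fun F g hF hg hbd hupd => ?_⟩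
  rw [hΘ]
  exact exists_setLIntegral_sub_mul_powFun_sq_le hN φ F g hF hg hbd hupd

end Summit.AtomisticToContinuum.BoseEinsteinCondensation.Theorems

end
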